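import Summits.CriticalPhenomena.PercolationContinuityZ3.Theorems.PercNearOneGluingNoHeavyLowerTailCILTwoPortFewRelaysTools
import Summits.CriticalPhenomena.PercolationContinuityZ3.Theorems.PercNearOneGluingNoHeavyLowerTailCILTwoPendantStarsTwoPort
import HarnessLib

/-!
# `NoHeavyLowerTail` (stmt-CriticalPhenomena-4575) — the two-sided core with a TWO-PORT star: `j ≤ 2` OR `|A| ≤ j + 3`

Support file (prover `prim-hp-2`, deletion–contraction / pivotal-edge line; `--supports stmt-CriticalPhenomena-4575`).
No definitions, no named facts, no sorries.  Notation as in `…CILTwoPortLevelTwo` (`μ_w`, relays `A`, level `j`, `π`, lightness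
`I_w`, `CS_w(S, i)`); the two-sided core TPS = `CS_H({s₁,s₂}, i)` for two pendant relay-stars and a relay `i` dominating the ports in
`H` itself.

`…CILTwoPortLevelTwo` proved the core when `s₂` has exactly two ports `c ≠ d` and `j ≤ 2`.  The level entered at ONE place
(`Hyperedge.levelTwo_compare`): on the star `σ_{cd}` a relay joined to the glued block `{c,d}` sees three relays.  The same exceptional
event is harmless whenever `|A| ≤ j + 3`: there the cluster of `s₁` avoids the three relays `i, c, d`, so it is light
(`Hyperedge.compare_of_fewRelays`, `…CILTwoPortFewRelaysTools`).  Everything else (`setCS_pair_of_hyperedgeDD`, the glued weight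
function `u = w[s₂c ↦ 1, s₂d ↦ Y]`, `Hyperedge.levelTwo_slack`) is level-free, so:

* `setCS_pair_twoPort_of_fewRelays` — the core for a two-port star under `j ≤ 2 ∨ |A| ≤ j + 3` (any number of ports of `s₁`, any
  graph elsewhere; `i ∉ {c,d}` dominating the ports in the graph itself);
* `tps_twoPort_of_fewRelays` — the same with the witness a champion `q` (the case `q ∈ {c,d}` is `tps_twoPort_of_witnessPort`, any `j`);
* `cil_twoPendantStars_twoPort_of_fewRelays` — the conclusion of `stub_cumulativeIsolation` at every observer whose hull is
  `{o, s₁, s₂}` with `s₁, s₂` non-adjacent pendant relay-stars one of which has exactly two ports, for `j ≤ 2 ∨ |A| ≤ j + 3`.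
  At the crux ladder `|A| = 5` (and `|A| = 6`) this is EVERY level `j`; the first level not covered is `(|A|, j) = (7, 3)`.
-/

noncomputable section

namespace Summit.CriticalPhenomena.PercolationContinuityZ3.Theorems

open MeasureTheory Set Literature.Probability.LatticeModels Literature.Probability.Percolation
open scoped Classical BigOperators

variable {n : ℕ}

open CutObserver KNPreFKG Hyperedge in
/-- **The two-sided core with a two-port star, `j ≤ 2` or `|A| ≤ j + 3`.**  Let `s₁ ≠ s₂` be non-relays, every positive-weight pair at `s₁`
ending in a relay and every positive-weight pair at `s₂` ending in one of two relays `c ≠ d`; let `i ∈ A ∖ {c, d}` satisfy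
`I_w(a) ≤ I_w(i)` for every port `a` of `s₁` and for `a ∈ {c, d}` (lightness in the graph itself), and let `j ≤ 2` or
`|A| ≤ j + 3`.  Then
`CS_w({s₁,s₂}, i)`: `μ_w(i ↮ {s₁,s₂}, 1 ≤ |π({s₁,s₂})| ≤ j) ≤ μ_w(i ↮ {s₁,s₂}, |π(i)| ≤ j)`.
[cite: VandenbergHaggstromKahn2005, Thm. 1.5 (p. 7) — via `observerSet_le_of_lonelier` and `lightnessSlack_relayNeighbours`] -/
theorem setCS_pair_twoPort_of_fewRelays (w : Sym2 (Fin n) → unitInterval) (A : Finset (Fin n)) (s₁ s₂ c d i : Fin n) (j : ℕ)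
    (hj : j ≤ 2 ∨ A.card ≤ j + 3) (hs₁A : s₁ ∉ A) (hs₂A : s₂ ∉ A) (h12 : s₁ ≠ s₂) (hcA : c ∈ A) (hdA : d ∈ A) (hcd : c ≠ d)
    (hiA : i ∈ A)
    (hic : i ≠ c) (hid : i ≠ d) (hobs₁ : ∀ v, w s(s₁, v) ≠ 0 → v ∈ A) (hobs₂ : ∀ v, v ≠ s₂ → w s(s₂, v) ≠ 0 → v = c ∨ v = d)
    (hdom : ∀ a ∈ A, (w s(s₁, a) ≠ 0 ∨ a = c ∨ a = d) →
      (prodBernoulli w).real {ω : BondConfig (Fin n) | (A.filter fun z => ω ∈ openConn a z).card ≤ j} ≤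
        (prodBernoulli w).real {ω : BondConfig (Fin n) | (A.filter fun z => ω ∈ openConn i z).card ≤ j}) :
    (prodBernoulli w).real {ω : BondConfig (Fin n) | (∀ x ∈ ({s₁, s₂} : Finset (Fin n)), ω ∉ openConn i x) ∧
        1 ≤ (A.filter fun z => ∃ x ∈ ({s₁, s₂} : Finset (Fin n)), ω ∈ openConn x z).card ∧
        (A.filter fun z => ∃ x ∈ ({s₁, s₂} : Finset (Fin n)), ω ∈ openConn x z).card ≤ j} ≤
      (prodBernoulli w).real {ω : BondConfig (Fin n) | (∀ x ∈ ({s₁, s₂} : Finset (Fin n)), ω ∉ openConn i x) ∧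
        (A.filter fun z => ω ∈ openConn i z).card ≤ j} := by
  haveI : ∀ u : Sym2 (Fin n) → unitInterval, IsProbabilityMeasure (prodBernoulli u) := fun u => inferInstance
  have hcs : c ≠ s₂ := fun h => hs₂A (h ▸ hcA)
  have hds : d ≠ s₂ := fun h => hs₂A (h ▸ hdA)
  have hi1 : i ≠ s₁ := fun h => hs₁A (h ▸ hiA)
  have hc1 : c ≠ s₁ := fun h => hs₁A (h ▸ hcA)
  have hd1 : d ≠ s₁ := fun h => hs₁A (h ▸ hdA)
  have hne : s(s₂, c) ≠ s(s₂, d) := fun h => hcd (Sym2.congr_right.1 h)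
  have hYmem : (w s(s₂, c) : ℝ) * w s(s₂, d) ∈ unitInterval := unitInterval.mul_mem (w s(s₂, c)).2 (w s(s₂, d)).2
  -- the glued weight function `u = w[s₂c ↦ 1, s₂d ↦ Y]`
  set u : Sym2 (Fin n) → unitInterval :=
    Function.update (Function.update w s(s₂, c) 1) s(s₂, d) ⟨(w s(s₂, c) : ℝ) * w s(s₂, d), hYmem⟩ with hu
  have hu_ed : u s(s₂, d) = ⟨(w s(s₂, c) : ℝ) * w s(s₂, d), hYmem⟩ := by rw [hu, Function.update_self]
  have hu_ec : u s(s₂, c) = 1 := by rw [hu, Function.update_of_ne hne, Function.update_self]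
  have hu_ne : ∀ e : Sym2 (Fin n), e ≠ s(s₂, c) → e ≠ s(s₂, d) → u e = w e := fun e h1 h2 => by
    rw [hu, Function.update_of_ne h2, Function.update_of_ne h1]
  have hu_off : ∀ e : Sym2 (Fin n), s₂ ∉ e → u e = w e :=
    fun e he => hu_ne e (fun h => he (h ▸ Sym2.mem_mk_left s₂ c)) (fun h => he (h ▸ Sym2.mem_mk_left s₂ d))
  have hobs_u : ∀ y, y ≠ s₂ → u s(s₂, y) ≠ 0 → y = c ∨ y = d := by
    intro y hy h
    by_cases hyc : y = c
    · exact Or.inl hyc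
    by_cases hyd : y = d
    · exact Or.inr hyd
    rw [hu_ne _ (fun h' => hyc (Sym2.congr_right.1 h')) (fun h' => hyd (Sym2.congr_right.1 h'))] at h
    exact hobs₂ y hy h
  have hY : ((u s(s₂, d) : unitInterval) : ℝ) = (w s(s₂, c) : ℝ) * w s(s₂, d) := by rw [hu_ed]
  have hglue : (u s(s₂, c) : ℝ) * u s(s₂, d) = (w s(s₂, c) : ℝ) * w s(s₂, d) := by
    rw [hu_ec, hY, Set.Icc.coe_one, one_mul]
  have hsame : ∀ x ∈ A, (prodBernoulli u).real {ω : BondConfig (Fin n) | (A.filter fun z => ω ∈ openConn x z).card ≤ j} =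
      (prodBernoulli w).real {ω : BondConfig (Fin n) | (A.filter fun z => ω ∈ openConn x z).card ≤ j} :=
    fun x hx => lightness_eq_of_sameGlue u w A s₂ c d x j hs₂A hx hcs hds hcd hobs_u hobs₂ hu_off hglue
  -- the gates of `s₁` together with `c, d`, listed
  set Pset : Finset (Fin n) := (A.filter fun a => w s(s₁, a) ≠ 0) ∪ {c, d} with hPset
  have hPA : Pset ⊆ A := by
    intro a ha
    rcases Finset.mem_union.1 ha with ha | ha
    · exact (Finset.mem_filter.1 ha).1
    · rcases Finset.mem_insert.1 ha with rfl | ha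
      · exact hcA
      · exact (Finset.mem_singleton.1 ha) ▸ hdA
  set m : ℕ := Pset.card with hm
  let p : Fin m → Fin n := fun l => ((Pset.equivFin.symm l) : Fin n)
  have hp : Function.Injective p := by
    intro l l' h
    exact Pset.equivFin.symm.injective (Subtype.ext h)
  have hpP : ∀ l, p l ∈ Pset := fun l => (Pset.equivFin.symm l).2
  have hpA : ∀ l, p l ∈ A := fun l => hPA (hpP l)
  have hsurj : ∀ v ∈ Pset, ∃ l, v = p l := fun v hv =>
    ⟨Pset.equivFin ⟨v, hv⟩, by show v = ((Pset.equivFin.symm (Pset.equivFin ⟨v, hv⟩)) : Fin n); rw [Equiv.symm_apply_apply]⟩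
  obtain ⟨lc, hlc⟩ := hsurj c (Finset.mem_union_right _ (by simp))
  have hobs₁u : ∀ v, u s(s₁, v) ≠ 0 → ∃ l, v = p l := by
    intro v hv
    have h1 : s(s₁, v) ≠ s(s₂, c) := fun h => by
      have := Sym2.eq_iff.1 h
      rcases this with ⟨h', -⟩ | ⟨h', -⟩
      · exact h12 h'
      · exact hc1 h'.symm
    have h2 : s(s₁, v) ≠ s(s₂, d) := fun h => by
      have := Sym2.eq_iff.1 h
      rcases this with ⟨h', -⟩ | ⟨h', -⟩
      · exact h12 h'
      · exact hd1 h'.symm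
    rw [hu_ne _ h1 h2] at hv
    exact hsurj v (Finset.mem_union_left _ (Finset.mem_filter.2 ⟨hobs₁ v hv, hv⟩))
  have hdom_u : ∀ l : Fin m, (prodBernoulli u).real {ω : BondConfig (Fin n) | (A.filter fun z => ω ∈ openConn (p l) z).card ≤ j} ≤
      (prodBernoulli u).real {ω : BondConfig (Fin n) | (A.filter fun z => ω ∈ openConn i z).card ≤ j} := by
    intro l
    rw [hsame (p l) (hpA l), hsame i hiA]
    refine hdom (p l) (hpA l) ?_
    rcases Finset.mem_union.1 (hpP l) with h | h
    · exact Or.inl (Finset.mem_filter.1 h).2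
    · rcases Finset.mem_insert.1 h with h | h
      · exact Or.inr (Or.inl h)
      · exact Or.inr (Or.inr (Finset.mem_singleton.1 h))
  -- the two level-two lemmas in `u`
  have hslack := levelTwo_slack u A s₁ s₂ c d i j p hp hpA hs₁A hs₂A h12 hcd hdA hobs₁u ⟨lc, hlc.symm⟩ hobs_u hu_ec hdom_u
  have hcomp := compare_of_fewRelays u A s₁ s₂ c d i j hj p hpA hs₁A hs₂A h12 hcA hdA hcd hiA hic hid hobs₁u hobs_u hu_ec
  -- `CSdiff_u({s₁}, i) = I_u(i) − μ_u{1 ≤ |π(s₁)| ≤ j}`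
  have hIL : (prodBernoulli u).real {ω : BondConfig (Fin n) | (A.filter fun z => ω ∈ openConn i z).card ≤ j} -
      (prodBernoulli u).real {ω : BondConfig (Fin n) |
        1 ≤ (A.filter fun z => ω ∈ openConn s₁ z).card ∧ (A.filter fun z => ω ∈ openConn s₁ z).card ≤ j} =
      (prodBernoulli u).real {ω : BondConfig (Fin n) | ω ∉ openConn i s₁ ∧ (A.filter fun z => ω ∈ openConn i z).card ≤ j} -
      (prodBernoulli u).real {ω : BondConfig (Fin n) | ω ∉ openConn i s₁ ∧
        1 ≤ (A.filter fun z => ω ∈ openConn s₁ z).card ∧ (A.filter fun z => ω ∈ openConn s₁ z).card ≤ j} := by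
    set I := {ω : BondConfig (Fin n) | (A.filter fun z => ω ∈ openConn i z).card ≤ j} with hI
    set Ls := {ω : BondConfig (Fin n) |
      1 ≤ (A.filter fun z => ω ∈ openConn s₁ z).card ∧ (A.filter fun z => ω ∈ openConn s₁ z).card ≤ j} with hLs
    set D : Set (BondConfig (Fin n)) := openConn i s₁ with hD
    have h1 := measureReal_inter_add_sdiff (μ := prodBernoulli u) (s := I) (MeasurableSet.of_discrete (s := D))
    have h2 := measureReal_inter_add_sdiff (μ := prodBernoulli u) (s := Ls) (MeasurableSet.of_discrete (s := D))
    have hID : I ∩ D = Ls ∩ D := by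
      ext ω
      simp only [hI, hLs, hD, mem_inter_iff, mem_setOf_eq]
      constructor
      · rintro ⟨h, hω⟩
        have heq : (A.filter fun z => ω ∈ openConn s₁ z) = (A.filter fun z => ω ∈ openConn i z) :=
          Finset.filter_congr fun z _ =>
            ⟨fun hz => SimpleGraph.Reachable.trans hω hz, fun hz => SimpleGraph.Reachable.trans (SimpleGraph.Reachable.symm hω) hz⟩
        refine ⟨⟨?_, by rw [heq]; exact h⟩, hω⟩
        rw [heq]
        exact Finset.card_pos.2 ⟨i, Finset.mem_filter.2 ⟨hiA, SimpleGraph.Reachable.refl _⟩⟩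
      · rintro ⟨⟨-, h⟩, hω⟩
        have heq : (A.filter fun z => ω ∈ openConn s₁ z) = (A.filter fun z => ω ∈ openConn i z) :=
          Finset.filter_congr fun z _ =>
            ⟨fun hz => SimpleGraph.Reachable.trans hω hz, fun hz => SimpleGraph.Reachable.trans (SimpleGraph.Reachable.symm hω) hz⟩
        exact ⟨by rw [← heq]; exact h, hω⟩
    have hI' : I \ D = {ω : BondConfig (Fin n) | ω ∉ openConn i s₁ ∧ (A.filter fun z => ω ∈ openConn i z).card ≤ j} := by
      ext ω; simp only [hI, hD, mem_sdiff, mem_setOf_eq]; tauto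
    have hL' : Ls \ D = {ω : BondConfig (Fin n) | ω ∉ openConn i s₁ ∧
        1 ≤ (A.filter fun z => ω ∈ openConn s₁ z).card ∧ (A.filter fun z => ω ∈ openConn s₁ z).card ≤ j} := by
      ext ω; simp only [hLs, hD, mem_sdiff, mem_setOf_eq]; tauto
    rw [← hI', ← hL']
    rw [hID] at h1
    linarith
  -- the hyperedge inequality in `u`, then moved to `w`
  have hDDu : 0 ≤ (1 - (u s(s₂, d) : ℝ)) *
        ((prodBernoulli u).real {ω : BondConfig (Fin n) |
            (∀ y ∈ ({s₁} : Finset (Fin n)), ¬ (openGraph (ω ∩ {e | s₂ ∉ e})).Reachable i y) ∧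
              (A.filter fun z => (openGraph (ω ∩ {e | s₂ ∉ e})).Reachable i z).card ≤ j} -
          (prodBernoulli u).real {ω : BondConfig (Fin n) |
            (∀ y ∈ ({s₁} : Finset (Fin n)), ¬ (openGraph (ω ∩ {e | s₂ ∉ e})).Reachable i y) ∧
              1 ≤ (A.filter fun z => ∃ y ∈ ({s₁} : Finset (Fin n)), (openGraph (ω ∩ {e | s₂ ∉ e})).Reachable y z).card ∧
              (A.filter fun z => ∃ y ∈ ({s₁} : Finset (Fin n)), (openGraph (ω ∩ {e | s₂ ∉ e})).Reachable y z).card ≤ j}) +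
      (u s(s₂, d) : ℝ) *
        ((prodBernoulli u).real {ω : BondConfig (Fin n) |
            (∀ y ∈ ({s₁} ∪ {c, d} : Finset (Fin n)), ¬ (openGraph (ω ∩ {e | s₂ ∉ e})).Reachable i y) ∧
              (A.filter fun z => (openGraph (ω ∩ {e | s₂ ∉ e})).Reachable i z).card ≤ j} -
          (prodBernoulli u).real {ω : BondConfig (Fin n) |
            (∀ y ∈ ({s₁} ∪ {c, d} : Finset (Fin n)), ¬ (openGraph (ω ∩ {e | s₂ ∉ e})).Reachable i y) ∧
              1 ≤ (A.filter fun z => ∃ y ∈ ({s₁} ∪ {c, d} : Finset (Fin n)), (openGraph (ω ∩ {e | s₂ ∉ e})).Reachable y z).card ∧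
              (A.filter fun z => ∃ y ∈ ({s₁} ∪ {c, d} : Finset (Fin n)),
                (openGraph (ω ∩ {e | s₂ ∉ e})).Reachable y z).card ≤ j}) := by
    have hnn : 0 ≤ (u s(s₂, d) : ℝ) * ((prodBernoulli u).real {ω : BondConfig (Fin n) | ∀ l, s(s₁, p l) ∉ ω} *
        (prodBernoulli u).real {ω : BondConfig (Fin n) |
          (A.filter fun z => (openGraph ((ω ∩ {e | s₁ ∉ e}) ∩ {e | s₂ ∉ e})).Reachable c z ∨
            (openGraph ((ω ∩ {e | s₁ ∉ e}) ∩ {e | s₂ ∉ e})).Reachable d z).card ≤ j}) :=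
      mul_nonneg (u s(s₂, d)).2.1 (mul_nonneg measureReal_nonneg measureReal_nonneg)
    nlinarith [hslack, hcomp, hIL, hnn]
  -- transfer the off-`s₂` terms from `u` to `w`
  have hwoff : (fun e => if e ∈ {e : Sym2 (Fin n) | s₂ ∉ e} then u e else 0) =
      (fun e => if e ∈ {e : Sym2 (Fin n) | s₂ ∉ e} then w e else 0) := by
    funext e
    by_cases he : s₂ ∉ e
    · simp only [mem_setOf_eq, he, not_false_eq_true, if_true, hu_off e he]
    · simp only [mem_setOf_eq, he, if_false]
  have htr : ∀ S : Set (BondConfig (Fin n)), (prodBernoulli u).real {ω | ω ∩ {e | s₂ ∉ e} ∈ S} =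
      (prodBernoulli w).real {ω | ω ∩ {e | s₂ ∉ e} ∈ S} := by
    intro S
    rw [measureReal_preimage_avoid u s₂ S, measureReal_preimage_avoid w s₂ S, hwoff]
  have hdomc := hdom c hcA (Or.inr (Or.inl rfl))
  have hdomd := hdom d hdA (Or.inr (Or.inr rfl))
  refine setCS_pair_of_hyperedgeDD w A s₁ s₂ c d i j hs₂A h12 hcA hdA hcd hiA hi1 hobs₂ hdomc hdomd ?_
  have e1 := htr {ξ : BondConfig (Fin n) | (∀ y ∈ ({s₁} : Finset (Fin n)), ¬ (openGraph ξ).Reachable i y) ∧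
    (A.filter fun z => (openGraph ξ).Reachable i z).card ≤ j}
  have e2 := htr {ξ : BondConfig (Fin n) | (∀ y ∈ ({s₁} : Finset (Fin n)), ¬ (openGraph ξ).Reachable i y) ∧
    1 ≤ (A.filter fun z => ∃ y ∈ ({s₁} : Finset (Fin n)), (openGraph ξ).Reachable y z).card ∧
    (A.filter fun z => ∃ y ∈ ({s₁} : Finset (Fin n)), (openGraph ξ).Reachable y z).card ≤ j}
  have e3 := htr {ξ : BondConfig (Fin n) | (∀ y ∈ ({s₁} ∪ {c, d} : Finset (Fin n)), ¬ (openGraph ξ).Reachable i y) ∧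
    (A.filter fun z => (openGraph ξ).Reachable i z).card ≤ j}
  have e4 := htr {ξ : BondConfig (Fin n) | (∀ y ∈ ({s₁} ∪ {c, d} : Finset (Fin n)), ¬ (openGraph ξ).Reachable i y) ∧
    1 ≤ (A.filter fun z => ∃ y ∈ ({s₁} ∪ {c, d} : Finset (Fin n)), (openGraph ξ).Reachable y z).card ∧
    (A.filter fun z => ∃ y ∈ ({s₁} ∪ {c, d} : Finset (Fin n)), (openGraph ξ).Reachable y z).card ≤ j}
  simp only [mem_setOf_eq] at e1 e2 e3 e4
  rw [← e1, ← e2, ← e3, ← e4, ← hY]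
  exact hDDu

open CutObserver in
/-- **TPS when one star has exactly two ports, `j ≤ 2` or `|A| ≤ j + 3`.**  `s₁ ≠ s₂` non-relays; the positive-weight pairs at `s₁` end in
relays (at least one), those at `s₂` in `c` or `d` (relays, `c ≠ d`); `q` a champion of `A` in `w`; `j ≤ 2` or `|A| ≤ j + 3`.
Then `CS_w({s₁,s₂}, q)`.  (`q ∉ {c,d}`: `setCS_pair_twoPort_of_fewRelays`; `q ∈ {c,d}`: `tps_twoPort_of_witnessPort`, any `j`.)
[cite: VandenbergHaggstromKahn2005, Thm. 1.5 (p. 7)] -/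
theorem tps_twoPort_of_fewRelays (w : Sym2 (Fin n) → unitInterval) (A : Finset (Fin n)) (s₁ s₂ c d q : Fin n) (j : ℕ)
    (hj : j ≤ 2 ∨ A.card ≤ j + 3) (hs₁A : s₁ ∉ A) (hs₂A : s₂ ∉ A) (h12 : s₁ ≠ s₂) (hcA : c ∈ A) (hdA : d ∈ A) (hcd : c ≠ d)
    (hqA : q ∈ A)
    (hobs₁ : ∀ v, w s(s₁, v) ≠ 0 → v ∈ A) (hne₁ : ∃ v, w s(s₁, v) ≠ 0)
    (hobs₂ : ∀ v, v ≠ s₂ → w s(s₂, v) ≠ 0 → v = c ∨ v = d)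
    (hchamp : ∀ a ∈ A, (prodBernoulli w).real {ω : BondConfig (Fin n) | (A.filter fun z => ω ∈ openConn a z).card ≤ j} ≤
      (prodBernoulli w).real {ω : BondConfig (Fin n) | (A.filter fun z => ω ∈ openConn q z).card ≤ j}) :
    (prodBernoulli w).real {ω : BondConfig (Fin n) | (∀ x ∈ ({s₁, s₂} : Finset (Fin n)), ω ∉ openConn q x) ∧
        1 ≤ (A.filter fun z => ∃ x ∈ ({s₁, s₂} : Finset (Fin n)), ω ∈ openConn x z).card ∧
        (A.filter fun z => ∃ x ∈ ({s₁, s₂} : Finset (Fin n)), ω ∈ openConn x z).card ≤ j} ≤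
      (prodBernoulli w).real {ω : BondConfig (Fin n) | (∀ x ∈ ({s₁, s₂} : Finset (Fin n)), ω ∉ openConn q x) ∧
        (A.filter fun z => ω ∈ openConn q z).card ≤ j} := by
  by_cases hqc : q = c
  · subst hqc
    exact tps_twoPort_of_witnessPort w A s₁ s₂ q d j hs₁A hs₂A h12 hqA hdA hcd hobs₁ hne₁ hobs₂ hchamp
  by_cases hqd : q = d
  · subst hqd
    exact tps_twoPort_of_witnessPort w A s₁ s₂ q c j hs₁A hs₂A h12 hqA hcA (Ne.symm hcd) hobs₁ hne₁
      (fun v hv h => (hobs₂ v hv h).symm) hchamp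
  exact setCS_pair_twoPort_of_fewRelays w A s₁ s₂ c d q j hj hs₁A hs₂A h12 hcA hdA hcd hqA hqc hqd hobs₁ hobs₂
    (fun a ha _ => hchamp a ha)

open CutObserver SubStar TwoPendantStars in
/-- **CIL for the two-pendant-stars observer when one star has two ports, `j ≤ 2` or `|A| ≤ j + 3`.**  Let `o ∉ A` have positive-weight neighbours
only among the relays and two non-relays `s₁ ≠ s₂`; apart from `o`, `s₁` has only relay neighbours (at least one) and `s₂` has only
relay neighbours, all among `c ≠ d` (two ports); let `q ∈ A` be an `H`-champion (`H` = no edge at `o`) and `j ≤ 2` or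
`|A| ≤ j + 3` (at the crux ladder `|A| = 5`: every `j`).  Then
`μ_w{1 ≤ N ≤ j} ≤ μ_w{|π(q)| ≤ j}` — the conclusion of `stub_cumulativeIsolation` (crux `NoHeavyLowerTail`, stmt-CriticalPhenomena-4575)
with the witness `q`.  Proof: `cil_twoPendantStars_of_TPS` (star transfer) + `tps_twoPort_of_fewRelays` in the weights with the pairs at
`o` switched off. [cite: VandenbergHaggstromKahn2005, Thm. 1.5 (p. 7); KozmaNitzan2024, Lemma 5 (p. 13) — star decomposition] -/
theorem cil_twoPendantStars_twoPort_of_fewRelays (w : Sym2 (Fin n) → unitInterval) (A : Finset (Fin n)) (o s₁ s₂ c d q : Fin n)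
    (j : ℕ) (hj : j ≤ 2 ∨ A.card ≤ j + 3) (hoA : o ∉ A) (hs₁A : s₁ ∉ A) (hs₂A : s₂ ∉ A) (hs₁o : s₁ ≠ o) (hs₂o : s₂ ≠ o) (h12 : s₁ ≠ s₂)
    (hcA : c ∈ A) (hdA : d ∈ A) (hcd : c ≠ d)
    (hobs : ∀ v, w s(o, v) ≠ 0 → v ∈ A ∨ v = s₁ ∨ v = s₂)
    (hobs₁ : ∀ v, v ≠ o → w s(s₁, v) ≠ 0 → v ∈ A) (hobs₂ : ∀ v, v ≠ o → w s(s₂, v) ≠ 0 → v ∈ A)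
    (htwo : ∀ v, v ≠ o → v ≠ s₂ → w s(s₂, v) ≠ 0 → v = c ∨ v = d)
    (hne₁ : ∃ v ∈ A, w s(s₁, v) ≠ 0) (hne₂ : ∃ v ∈ A, w s(s₂, v) ≠ 0) (hqA : q ∈ A)
    (hchamp : ∀ a ∈ A,
      (prodBernoulli w).real {ω : BondConfig (Fin n) |
          (A.filter fun z => (openGraph (ω ∩ {e | o ∉ e})).Reachable a z).card ≤ j} ≤
        (prodBernoulli w).real {ω : BondConfig (Fin n) |
          (A.filter fun z => (openGraph (ω ∩ {e | o ∉ e})).Reachable q z).card ≤ j}) :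
    (prodBernoulli w).real {ω : BondConfig (Fin n) |
        1 ≤ (A.filter fun x => ω ∈ openConn o x).card ∧ (A.filter fun x => ω ∈ openConn o x).card ≤ j} ≤
      (prodBernoulli w).real {ω : BondConfig (Fin n) | (A.filter fun x => ω ∈ openConn q x).card ≤ j} := by
  set wo : Sym2 (Fin n) → unitInterval := fun e => if e ∈ {e : Sym2 (Fin n) | o ∉ e} then w e else 0 with hwo
  have hwo_of : ∀ u v : Fin n, o ∉ s(u, v) → wo s(u, v) = w s(u, v) := by
    intro u v h; simp only [hwo, Set.mem_setOf_eq, h, not_false_eq_true, if_true]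
  have hwo_ne : ∀ u v : Fin n, wo s(u, v) ≠ 0 → o ∉ s(u, v) ∧ w s(u, v) ≠ 0 := by
    intro u v h
    by_cases ho : o ∉ s(u, v)
    · exact ⟨ho, by rwa [hwo_of u v ho] at h⟩
    · exfalso; apply h; simp only [hwo, Set.mem_setOf_eq, ho, if_false]
  have hobs₁' : ∀ v, wo s(s₁, v) ≠ 0 → v ∈ A := by
    intro v hv
    obtain ⟨ho, hw⟩ := hwo_ne s₁ v hv
    exact hobs₁ v (fun h => ho (h ▸ Sym2.mem_mk_right s₁ v)) hw
  have hne₁' : ∃ v, wo s(s₁, v) ≠ 0 := by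
    obtain ⟨v, hvA, hv⟩ := hne₁
    refine ⟨v, ?_⟩
    have ho : o ∉ s(s₁, v) := by
      rw [Sym2.mem_iff, not_or]; exact ⟨fun h => hs₁o h.symm, fun h => hoA (h ▸ hvA)⟩
    rw [hwo_of s₁ v ho]; exact hv
  have hobs₂' : ∀ v, v ≠ s₂ → wo s(s₂, v) ≠ 0 → v = c ∨ v = d := by
    intro v hv2 hv
    obtain ⟨ho, hw⟩ := hwo_ne s₂ v hv
    exact htwo v (fun h => ho (h ▸ Sym2.mem_mk_right s₂ v)) hv2 hw
  have hchamp' : ∀ a ∈ A, (prodBernoulli wo).real {ω : BondConfig (Fin n) | (A.filter fun z => ω ∈ openConn a z).card ≤ j} ≤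
      (prodBernoulli wo).real {ω : BondConfig (Fin n) | (A.filter fun z => ω ∈ openConn q z).card ≤ j} := by
    intro a ha
    have h := hchamp a ha
    rw [real_lightness_avoid w A o a j, real_lightness_avoid w A o q j] at h
    exact h
  have hTPS := tps_twoPort_of_fewRelays wo A s₁ s₂ c d q j hj hs₁A hs₂A h12 hcA hdA hcd hqA hobs₁' hne₁' hobs₂' hchamp'
  exact cil_twoPendantStars_of_TPS w A o s₁ s₂ q j hoA hs₁A hs₂A hs₁o hs₂o hobs hobs₁ hobs₂ hne₁ hne₂ hqA hchamp hTPS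

end Summit.CriticalPhenomena.PercolationContinuityZ3.Theorems

end
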